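import Summits.CriticalPhenomena.PercolationContinuityZ3.Theorems.PercNearOneGluingNoHeavyConstsLinearLowerTailTwoGluedBlocks
import HarnessLib

/-!
# The six-point inequality "at least two of five lost": what it would give — (LT³⁄₂) for `|A| = 7` and the next block class

builds on p205010 (kernel theorem, internal audit signed; external expert review pending)

PAPER-2 track "percolation constants", part (ii), seat `prim-consts-1`, gen 11 (lane index `run/shared/lean/prim/consts/CONSTANTS.md`,
row A19, §4 N31/N37; memo `FROM-prim-consts-1-g11-GLUED-BLOCK.md` §4–§5).  Support file for the crux `NoHeavyLowerTail`
(stmt-CriticalPhenomena-4575; `--supports`): ONE `Prop` definition (an OPEN statement, tagged `@[conjecture]`) and theorems about it;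
no sorries; standard axioms.  Nothing here claims the conjecture.

Notation: finite weighted graph on `Fin n` (`μ = prodBernoulli w`), observer `o`, marked points `x 0, …, x 4` (all `≠ o`; REPETITIONS
ALLOWED — a repeated lost point counts twice), `s ≥` every pairwise unreliability among the six points; relay set `A`, `N = |C(o) ∩ A|`,
`EN = Σ_{a∈A} P(o ↔ a)`, bad event `{1 ≤ N < κ·EN}`, `0 < κ ≤ 2/3`.

* `Consts.SixPointTwoLost` — **CONJECTURE (6P)**: `μ(o is cut from at least two of x 0, …, x 4) ≤ (3/2)·s`.  The five-point lemma
  `Consts.real_two_le_lost_le_three_halves` (vdBHK Thm 1.3) is the same statement for four points; with a repeated entry `(b,b,d₀,d₁,d₂)`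
  (6P) is the WEIGHTED five-point inequality W = "`b` lost, or two of `d₀,d₁,d₂` lost" (memo §4).  STATUS (numbers prove nothing):
  gen 6 (CONSTANTS §4 N31): numerically true on `≤ 9` vertices (adversarial exact searches, max `1.4999…`, always the hub-leaf limit) and
  NOT derivable from single-generator vdBHK conditional association ("needs ED/TS"); gen 11: for the sub-family W the partition-level
  relaxation with ALL vdBHK 1.3/1.4 constraints is exactly `13/8` (kit j151433, pseudo-law `½(o|1234) + ½(o234|1) + 3/16·Σ(o1ℓ|j|k) + …`),
  Positivstellensatz certificates are infeasible below `7/4`, while restricted to mutually GLUED lost points it is `3/2` (j151567): the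
  obstruction is SEPARATE simultaneous losses, i.e. exactly what the lane's splitting conjecture `Consts.TripleSplit` (p275338) controls
  (with TS at pair scale `s` the W-relaxation is `3/2 + O(√s)`, kit j152610).  CENSUS (kit famscan j150540/j150678/j150679/j153040,
  1 422 686 instances on ≤ 9 vertices, exact state enumeration, continuous closed-probabilities climbed from corner-biased starts): (6P)
  itself — 120 001 instances, max ratio `1.499999` (free), `1.4551` with all closed-probabilities in `[.02,.98]`; its sub-family W —
  216 471 instances, max `1.5` (supremum, hub-leaf degenerations), `1.4939` constrained; 0 exceedances of `3/2`.  The neighbouring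
  families "two of SIX lost" and "`b` doubled + four light points" are FALSE (ratios `1.997` and `1.998`: three disjoint pairs of lost
  points, each pair lost with probability `≈ s/2`; first found as `1.529·s` on the 7-cycle), so (6P) is the sharp member of its kind.
* `Consts.real_le_three_halves_of_two_of_five_lost_ae` — finishing step under (6P) (off a null set, two lost entries of a quintuple).
* `Consts.real_lowerTail_le_three_halves_of_card_le_seven_of_sixPoint` — **(6P) ⇒ (LT³⁄₂) for every instance with `|A| ≤ 7`, any
  observer** (the seven-point case, N28: `N_a < 5` means `a` loses three of six, hence two of any five fixed others).
* `Consts.real_blockDeficit_block_le_of_four_free` (unconditional, five-point lemma at four distinct free points) and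
  `Consts.real_blockDeficit_free_le_of_sixPoint`, giving
  `Consts.real_lowerTail_le_three_halves_of_glued_block_of_sixPoint` — **(6P) ⇒ (LT³⁄₂) for one glued block with
  `2·|A ∖ B| ≤ |B| + 9`**, i.e. `|A ∖ B| ≤ ⌊|A|/3⌋ + 3`: ONE more free point at each `|A|` than the unconditional
  `…_of_glued_block_half` (`|A ∖ B| ≤ ⌊|A|/3⌋ + 2`; the "+3" lives in the doubled form `+9` vs `+6` — referee gen 60 wording).
References: G. Kozma, N. Nitzan, arXiv:2401.12397 (2024), Conjecture 1 (p. 3), Conjecture 4 (p. 32); J. van den Berg, O. Häggström,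
J. Kahn, Random Structures Algorithms 29 (2006), Thm. 1.3; G. Grimmett, *Percolation* (1999), §1.3, §2.3.
-/

noncomputable section

namespace Summit.CriticalPhenomena.PercolationContinuityZ3.Theorems

open MeasureTheory Set Literature.Probability.LatticeModels Literature.Probability.Percolation
open scoped Classical

namespace Consts

/-- **CONJECTURE (6P) — at least two of five lost.**  For every finite weighted graph, observer `o`, points `x 0, …, x 4 ≠ o`
(repetitions allowed) and `s` bounding the pairwise unreliabilities `μ(o ↮ x k)`, `μ(x k ↮ x k')`:
`μ(|{k : o ↮ x k}| ≥ 2) ≤ (3/2)·s`.  OPEN (conjectured in this programme, PAPER-2 consts track, seat prim-consts-1; numerics gen 6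
(CONSTANTS §4 N31) and gen 11 never exceed `3/2`, sup attained only as a weak-edge weight tends to `0`; not provable from pair budgets +
vdBHK conditional association alone — see the module docstring).  Four points: the five-point lemma (kernel).  Six points: FALSE.
It would settle `|A| = 7` of (LT³⁄₂) (`Consts.real_lowerTail_le_three_halves_of_card_le_seven_of_sixPoint`) and extend the block
method by one more free point, `|A ∖ B| ≤ ⌊|A|/3⌋ + 3` vs `+ 2` (`Consts.real_lowerTail_le_three_halves_of_glued_block_of_sixPoint`).
builds on p205010 (kernel theorem, internal audit signed; external expert review pending).
[cite: VandenbergHaggstromKahn2005, Thm. 1.3 (p. 6)] [status: open] -/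
@[conjecture] def SixPointTwoLost : Prop :=
  ∀ (n : ℕ) (w : Sym2 (Fin n) → unitInterval) (o : Fin n) (x : Fin 5 → Fin n), (∀ k, x k ≠ o) →
    ∀ s : ℝ, (∀ k, (prodBernoulli w).real (openConn o (x k))ᶜ ≤ s) →
      (∀ k k', (prodBernoulli w).real (openConn (x k) (x k'))ᶜ ≤ s) →
      (prodBernoulli w).real {ω : BondConfig (Fin n) | 2 ≤ (Finset.univ.filter fun k => ω ∉ openConn o (x k)).card} ≤ 3 / 2 * s

/-- **Finishing step under (6P).**  If, off a null set `Z`, the event `E` forces the relay point `a ∈ A` to be cut from two ENTRIES of a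
fixed quintuple `x : Fin 5 → A ∖ {a}` (repetitions allowed), then `μ(E) ≤ (3/2)·s` — assuming `Consts.SixPointTwoLost`.
[cite: KozmaNitzan2024, Conj. 4 (p. 32)] -/
theorem real_le_three_halves_of_two_of_five_lost_ae (h6 : SixPointTwoLost) (n : ℕ) (w : Sym2 (Fin n) → unitInterval)
    (A : Finset (Fin n)) (a : Fin n) (ha : a ∈ A) {s : ℝ}
    (hrel : ∀ b ∈ A, ∀ b' ∈ A, (prodBernoulli w).real (openConn b b')ᶜ ≤ s)
    (x : Fin 5 → Fin n) (hxA : ∀ k, x k ∈ A) (hxa : ∀ k, x k ≠ a) (Z E : Set (BondConfig (Fin n)))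
    (hZ : (prodBernoulli w).real Z = 0)
    (hsub : E ∩ Zᶜ ⊆ {ω | 2 ≤ (Finset.univ.filter fun k => ω ∉ openConn a (x k)).card}) :
    (prodBernoulli w).real E ≤ 3 / 2 * s :=
  (measureReal_le_of_inter_compl_subset hZ hsub).trans
    (h6 n w a x hxa s (fun k => hrel a ha (x k) (hxA k)) (fun k k' => hrel (x k) (hxA k) (x k') (hxA k')))

/-! ### (6P) ⇒ the seven-point case of (LT³⁄₂) -/

/-- **Block deficit for `|A| = 7` under (6P).**  If `|A| = 7`, every pair of `A` is `≤ s`-unreliable and `a ∈ A`, then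
`μ(N_a < 5) ≤ (3/2)·s`: `N_a < 5` means that `a` loses at least three of the six other relay points, hence at least two of any five of
them. [cite: KozmaNitzan2024, Conj. 4 (p. 32)] -/
theorem real_blockDeficit_five_le_of_sixPoint (h6 : SixPointTwoLost) (n : ℕ) (w : Sym2 (Fin n) → unitInterval)
    (A : Finset (Fin n)) (hA : A.card = 7) {s : ℝ} (hrel : ∀ b ∈ A, ∀ b' ∈ A, (prodBernoulli w).real (openConn b b')ᶜ ≤ s)
    (a : Fin n) (ha : a ∈ A) :
    (prodBernoulli w).real {ω : BondConfig (Fin n) | (A.filter fun b => ω ∈ openConn a b).card < 5} ≤ 3 / 2 * s := by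
  -- five relay points other than `a`
  have h5 : 5 ≤ (A.erase a).card := by rw [Finset.card_erase_of_mem ha]; omega
  obtain ⟨C, hC, hC5⟩ := Finset.exists_subset_card_eq h5
  set ε := C.equivFinOfCardEq hC5 with hε
  set x : Fin 5 → Fin n := fun j => ((ε.symm j : C) : Fin n) with hx
  have hxC : ∀ j, x j ∈ C := fun j => (ε.symm j).2
  have hxA : ∀ j, x j ∈ A := fun j => (Finset.mem_erase.1 (hC (hxC j))).2
  have hxa : ∀ j, x j ≠ a := fun j => (Finset.mem_erase.1 (hC (hxC j))).1
  have hxinj : Function.Injective x := by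
    intro j j' hjj
    have : ε.symm j = ε.symm j' := Subtype.ext hjj
    exact ε.symm.injective this
  have hCmap : C = Finset.univ.map ⟨x, hxinj⟩ := by
    ext b
    simp only [Finset.mem_map, Finset.mem_univ, Function.Embedding.coeFn_mk, true_and]
    constructor
    · intro hb
      exact ⟨ε ⟨b, hb⟩, by simp [hx]⟩
    · rintro ⟨j, rfl⟩
      exact hxC j
  refine real_le_three_halves_of_two_of_five_lost_ae h6 n w A a ha hrel x hxA hxa ∅ _ measureReal_empty ?_
  rintro ω ⟨hN, -⟩
  simp only [mem_setOf_eq] at hN ⊢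
  set L := A.filter fun b => ω ∉ openConn a b with hL
  have hsplit := Finset.card_filter_add_card_filter_not (s := A) (fun b => ω ∈ openConn a b)
  -- the lost set lies in `A.erase a` and has ≥ 3 elements
  have hLsub : L ⊆ A.erase a := by
    intro b hb
    have hb' := Finset.mem_filter.1 hb
    refine Finset.mem_erase.2 ⟨?_, hb'.1⟩
    rintro rfl
    exact hb'.2 (SimpleGraph.Reachable.refl _)
  have hLC := Finset.card_inter_add_card_sdiff C L
  have hout : (C \ L).card ≤ ((A.erase a) \ L).card := Finset.card_le_card (Finset.sdiff_subset_sdiff hC le_rfl)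
  have hEL : ((A.erase a) \ L).card + L.card = (A.erase a).card := by rw [Finset.card_sdiff_add_card_eq_card hLsub]
  have hE : (A.erase a).card = 6 := by rw [Finset.card_erase_of_mem ha]; omega
  have hin : 2 ≤ (C ∩ L).card := by
    have : L.card = (A.filter fun b => ω ∉ openConn a b).card := rfl
    omega
  have hidx : (C ∩ L).card = (Finset.univ.filter fun j => ω ∉ openConn a (x j)).card := by
    have : C ∩ L = C.filter fun b => ω ∉ openConn a b := by
      ext b
      simp only [Finset.mem_inter, Finset.mem_filter, hL]
      constructor
      · rintro ⟨hbC, _, hb⟩; exact ⟨hbC, hb⟩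
      · rintro ⟨hbC, hb⟩; exact ⟨hbC, (Finset.mem_erase.1 (hC hbC)).2, hb⟩
    rw [this, hCmap, Finset.filter_map, Finset.card_map]
    rfl
  rw [hidx] at hin
  exact hin

/-- **(6P) ⇒ (LT³⁄₂) for every instance with `|A| ≤ 7`, ANY observer, every `0 < κ ≤ 2/3`.**  `|A| ≤ 6` is unconditional
(`Consts.real_lowerTail_le_three_halves_of_card_le_six_any`); for `|A| = 7` the bad event lies in `{1 ≤ N < 5}` (`κ·EN ≤ 14/3 < 5`),
the footprint transfer `Consts.lowerTail_le_blockDeficit` reduces to the block deficits `μ(N_a < 5)`, and these are `≤ (3/2)s` by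
`Consts.real_blockDeficit_five_le_of_sixPoint`.  This is the seven-point case (CONSTANTS §4 N28: degree-2/3 certificates from vdBHK
stop at `14/9` / `1.545`). [cite: KozmaNitzan2024, Conj. 1 (p. 3)] -/
theorem real_lowerTail_le_three_halves_of_card_le_seven_of_sixPoint (h6 : SixPointTwoLost) (n : ℕ)
    (w : Sym2 (Fin n) → unitInterval) (A : Finset (Fin n)) (o : Fin n) (hA : A.card ≤ 7) {κ s : ℝ} (hκ0 : 0 < κ)
    (hκ : κ ≤ 2 / 3) (hs : 0 ≤ s) (hrel : ∀ a ∈ A, ∀ a' ∈ A, (prodBernoulli w).real (openConn a a')ᶜ ≤ s) :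
    (prodBernoulli w).real {ω : BondConfig (Fin n) | 1 ≤ (A.filter fun a => ω ∈ openConn o a).card ∧
        ((A.filter fun a => ω ∈ openConn o a).card : ℝ) < κ * (∑ a ∈ A, (prodBernoulli w).real (openConn o a))} ≤
      3 / 2 * s := by
  by_cases hA6 : A.card ≤ 6
  · exact real_lowerTail_le_three_halves_of_card_le_six_any n w A o hA6 hκ0 hκ hs hrel
  have hA7 : A.card = 7 := by omega
  set μ := prodBernoulli w with hμ
  have hblk : ∀ a ∈ A, μ.real {ω : BondConfig (Fin n) | (A.filter fun b => ω ∈ openConn a b).card < 5} ≤ 3 / 2 * s :=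
    fun a ha => real_blockDeficit_five_le_of_sixPoint h6 n w A hA7 hrel a ha
  have htr := lowerTail_le_blockDeficit n w A o 5 (3 / 2 * s) hblk
  have h32 : 3 / 2 * s * μ.real (⋃ a ∈ A, openConn o a) ≤ 3 / 2 * s := by
    have h0 : 0 ≤ 3 / 2 * s := by linarith
    have h1 : μ.real (⋃ a ∈ A, openConn o a) ≤ 1 := measureReal_le_one
    nlinarith [measureReal_nonneg (μ := μ) (s := ⋃ a ∈ A, openConn o a)]
  refine le_trans (measureReal_mono ?_) (htr.trans h32)
  intro ω hω
  simp only [mem_setOf_eq] at hω ⊢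
  obtain ⟨h1, hlt⟩ := hω
  refine ⟨h1, ?_⟩
  have hEN : (∑ a ∈ A, μ.real (openConn o a)) ≤ A.card := sum_real_openConn_le_card n w A o
  have h7 : (A.card : ℝ) = 7 := by exact_mod_cast hA7
  have hk : κ * (∑ a ∈ A, μ.real (openConn o a)) < 5 := by
    calc κ * (∑ a ∈ A, μ.real (openConn o a)) ≤ κ * A.card := mul_le_mul_of_nonneg_left hEN hκ0.le
      _ ≤ 2 / 3 * 7 := by rw [h7]; exact mul_le_mul_of_nonneg_right hκ (by norm_num)
      _ < 5 := by norm_num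
  have : ((A.filter fun a => ω ∈ openConn o a).card : ℝ) < 5 := lt_trans hlt hk
  exact_mod_cast this

/-- **(6P) ⇒ (LT³⁄₂) for `|A| ≤ 7` in the quantifier shape of `Consts.LinearLowerTailThreeHalves`.**
[cite: KozmaNitzan2024, Conj. 1 (p. 3)] -/
theorem linearLowerTailThreeHalves_of_card_le_seven_of_sixPoint (h6 : SixPointTwoLost) :
    ∀ κ : ℝ, 0 < κ → κ ≤ 2 / 3 →
      ∀ (n : ℕ) (w : Sym2 (Fin n) → unitInterval) (A : Finset (Fin n)) (o : Fin n) (s : ℝ), 0 ≤ s → A.card ≤ 7 →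
        (∀ a ∈ A, ∀ a' ∈ A, (prodBernoulli w).real (openConn a a')ᶜ ≤ s) →
        (prodBernoulli w).real {ω : BondConfig (Fin n) | 1 ≤ (A.filter fun a => ω ∈ openConn o a).card ∧
            ((A.filter fun a => ω ∈ openConn o a).card : ℝ) < κ * (∑ a ∈ A, (prodBernoulli w).real (openConn o a))} ≤
          3 / 2 * s :=
  fun _ hκ0 hκ n w A o _ hs hA hrel => real_lowerTail_le_three_halves_of_card_le_seven_of_sixPoint h6 n w A o hA hκ0 hκ hs hrel

/-! ### (6P) ⇒ the next block class -/

/-- **Block-point deficit with four free points (unconditional).**  `B ⊆ A` almost surely glued to `t`, `a ∈ B`, four distinct free points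
`C ⊆ A ∖ B` (`|C| = 4`), and `|A ∖ B| + k ≤ |A| + 3` (the deficit `N_a < k` forces at least `|A ∖ B| − 2` lost points).  Then
`μ(N_a < k) ≤ (3/2)·s`: off the glue null set `a` keeps `B`, loses all but at most two free points, hence two of the four points of `C`
— the five-point lemma. [cite: VandenbergHaggstromKahn2005, Thm. 1.3 (p. 6)] -/
theorem real_blockDeficit_block_le_of_four_free (n : ℕ) (w : Sym2 (Fin n) → unitInterval) (A : Finset (Fin n)) (t : Fin n)
    (B : Finset (Fin n)) (hBA : B ⊆ A) (hglue : ∀ b ∈ B, (prodBernoulli w).real (openConn t b)ᶜ = 0)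
    (a : Fin n) (haB : a ∈ B) (C : Finset (Fin n)) (hC : C ⊆ A \ B) (hC4 : C.card = 4) (k : ℕ)
    (hk : (A \ B).card + k ≤ A.card + 3) {s : ℝ} (hrel : ∀ b ∈ A, ∀ b' ∈ A, (prodBernoulli w).real (openConn b b')ᶜ ≤ s) :
    (prodBernoulli w).real {ω : BondConfig (Fin n) | (A.filter fun b => ω ∈ openConn a b).card < k} ≤ 3 / 2 * s := by
  have haA : a ∈ A := hBA haB
  -- enumerate `C`
  set ε := C.equivFinOfCardEq hC4 with hε
  set x : Fin 4 → Fin n := fun j => ((ε.symm j : C) : Fin n) with hx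
  have hxC : ∀ j, x j ∈ C := fun j => (ε.symm j).2
  have hxA : ∀ j, x j ∈ A := fun j => (Finset.mem_sdiff.1 (hC (hxC j))).1
  have hxa : ∀ j, x j ≠ a := fun j h => (Finset.mem_sdiff.1 (hC (hxC j))).2 (h ▸ haB)
  have hxinj : Function.Injective x := by
    intro j j' hjj
    have : ε.symm j = ε.symm j' := Subtype.ext hjj
    exact ε.symm.injective this
  have hCmap : C = Finset.univ.map ⟨x, hxinj⟩ := by
    ext b
    simp only [Finset.mem_map, Finset.mem_univ, Function.Embedding.coeFn_mk, true_and]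
    constructor
    · intro hb
      exact ⟨ε ⟨b, hb⟩, by simp [hx]⟩
    · rintro ⟨j, rfl⟩
      exact hxC j
  refine real_le_three_halves_of_two_lost_ae n w A a haA hrel x hxA hxa _ _
    (real_biUnion_compl_openConn_eq_zero n w t B hglue) ?_
  rintro ω ⟨hN, hωZ⟩
  simp only [mem_setOf_eq] at hN ⊢
  have htb : ∀ b' ∈ B, ω ∈ openConn t b' := by
    intro b' hb'
    by_contra h
    exact hωZ (Set.mem_iUnion₂.2 ⟨b', hb', h⟩)
  have hB : ∀ b' ∈ B ∪ (∅ : Finset (Fin n)), ω ∈ openConn a b' := by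
    intro b' hb'
    rw [Finset.union_empty] at hb'
    exact SimpleGraph.Reachable.trans (SimpleGraph.Reachable.symm (htb a haB)) (htb b' hb')
  obtain ⟨hsub, hcard⟩ := lostSet_sub_free_of_blocks_kept A B ∅ a ω hB k hN
  rw [Finset.union_empty, Finset.erase_eq_of_notMem (fun h => (Finset.mem_sdiff.1 h).2 haB)] at hsub
  -- `|L ∩ C| ≥ 2`
  set L := A.filter fun b => ω ∉ openConn a b with hL
  have hLC := Finset.card_inter_add_card_sdiff C L
  have hout : (C \ L).card ≤ ((A \ B) \ L).card := Finset.card_le_card (Finset.sdiff_subset_sdiff hC le_rfl)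
  have hFL : ((A \ B) \ L).card + L.card = (A \ B).card := by
    rw [Finset.card_sdiff_add_card_eq_card hsub]
  have hin : 2 ≤ (C ∩ L).card := by omega
  -- translate to indices
  have hidx : (C ∩ L).card = (Finset.univ.filter fun j => ω ∉ openConn a (x j)).card := by
    have : C ∩ L = C.filter fun b => ω ∉ openConn a b := by
      ext b
      simp only [Finset.mem_inter, Finset.mem_filter, hL]
      constructor
      · rintro ⟨hbC, _, hb⟩; exact ⟨hbC, hb⟩
      · rintro ⟨hbC, hb⟩; exact ⟨hbC, (Finset.mem_sdiff.1 (hC hbC)).1, hb⟩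
    rw [this, hCmap, Finset.filter_map, Finset.card_map]
    rfl
  rw [hidx] at hin
  exact hin

/-- **Free-point deficit via (6P).**  `B ⊆ A` almost surely glued to `t`, `b ∈ B`; a free point `a ∈ A ∖ B` and three distinct further
free points `d₀, d₁, d₂ ∈ (A ∖ B) ∖ {a}` such that the free points other than `a, d₀, d₁, d₂` number at most `|A| − k − 1` (`hcov`).
Then, ASSUMING `Consts.SixPointTwoLost`, `μ(N_a < k) ≤ (3/2)·s`: off the glue null set, if `a` keeps `b` it keeps the block and its lost
set (of size `≥ |A| + 1 − k`, inside `(A ∖ B) ∖ {a}`) contains two of `d₀, d₁, d₂`; otherwise it loses `b`, which is entered twice in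
the quintuple `(b, b, d₀, d₁, d₂)`. [cite: KozmaNitzan2024, Conj. 4 (p. 32)] -/
theorem real_blockDeficit_free_le_of_sixPoint (h6 : SixPointTwoLost) (n : ℕ) (w : Sym2 (Fin n) → unitInterval)
    (A : Finset (Fin n)) (t : Fin n) (B : Finset (Fin n)) (hBA : B ⊆ A)
    (hglue : ∀ b ∈ B, (prodBernoulli w).real (openConn t b)ᶜ = 0) (b : Fin n) (hb : b ∈ B)
    (a d₀ d₁ d₂ : Fin n) (ha : a ∈ A \ B) (hd₀ : d₀ ∈ (A \ B).erase a) (hd₁ : d₁ ∈ (A \ B).erase a) (hd₂ : d₂ ∈ (A \ B).erase a)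
    (h01 : d₀ ≠ d₁) (h02 : d₀ ≠ d₂) (h12 : d₁ ≠ d₂) (k : ℕ)
    (hcov : (((A \ B).erase a) \ {d₀, d₁, d₂}).card + k + 1 ≤ A.card) {s : ℝ}
    (hrel : ∀ b ∈ A, ∀ b' ∈ A, (prodBernoulli w).real (openConn b b')ᶜ ≤ s) :
    (prodBernoulli w).real {ω : BondConfig (Fin n) | (A.filter fun b => ω ∈ openConn a b).card < k} ≤ 3 / 2 * s := by
  have haA : a ∈ A := (Finset.mem_sdiff.1 ha).1
  have haB : a ∉ B := (Finset.mem_sdiff.1 ha).2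
  have hdA : ∀ d, d ∈ (A \ B).erase a → d ∈ A ∧ d ≠ a := fun d hd =>
    ⟨(Finset.mem_sdiff.1 (Finset.mem_of_mem_erase hd)).1, Finset.ne_of_mem_erase hd⟩
  have hba : b ≠ a := fun h => haB (h ▸ hb)
  set x : Fin 5 → Fin n := ![b, b, d₀, d₁, d₂] with hx
  have hxA : ∀ j, x j ∈ A := fun j => by fin_cases j <;> simp [hx, hBA hb, (hdA d₀ hd₀).1, (hdA d₁ hd₁).1, (hdA d₂ hd₂).1]
  have hxa : ∀ j, x j ≠ a := fun j => by fin_cases j <;> simp [hx, hba, (hdA d₀ hd₀).2, (hdA d₁ hd₁).2, (hdA d₂ hd₂).2]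
  refine real_le_three_halves_of_two_of_five_lost_ae h6 n w A a haA hrel x hxA hxa _ _
    (real_biUnion_compl_openConn_eq_zero n w t B hglue) ?_
  rintro ω ⟨hN, hωZ⟩
  simp only [mem_setOf_eq] at hN ⊢
  have key : ∀ j j' : Fin 5, j ≠ j' → ω ∉ openConn a (x j) → ω ∉ openConn a (x j') →
      2 ≤ (Finset.univ.filter fun i : Fin 5 => ω ∉ openConn a (x i)).card := by
    intro j j' hjj hlj hlj'
    exact Finset.one_lt_card.2 ⟨j, Finset.mem_filter.2 ⟨Finset.mem_univ _, hlj⟩, j',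
      Finset.mem_filter.2 ⟨Finset.mem_univ _, hlj'⟩, hjj⟩
  have hx0 : x 0 = b := rfl
  have hx1 : x 1 = b := rfl
  have hx2 : x 2 = d₀ := rfl
  have hx3 : x 3 = d₁ := rfl
  have hx4 : x 4 = d₂ := rfl
  by_cases hab : ω ∈ openConn a b
  · -- block kept: the lost set lies in `(A ∖ B) ∖ {a}`, has `≥ |A| + 1 - k` elements, so contains two of `d₀, d₁, d₂`
    have htb : ∀ b' ∈ B, ω ∈ openConn t b' := by
      intro b' hb'
      by_contra h
      exact hωZ (Set.mem_iUnion₂.2 ⟨b', hb', h⟩)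
    have hB : ∀ b' ∈ B ∪ (∅ : Finset (Fin n)), ω ∈ openConn a b' := by
      intro b' hb'
      rw [Finset.union_empty] at hb'
      exact SimpleGraph.Reachable.trans hab
        (SimpleGraph.Reachable.trans (SimpleGraph.Reachable.symm (htb b hb)) (htb b' hb'))
    obtain ⟨hsub, hcard⟩ := lostSet_sub_free_of_blocks_kept A B ∅ a ω hB k hN
    rw [Finset.union_empty] at hsub
    have hLsplit := Finset.card_inter_add_card_sdiff (A.filter fun b => ω ∉ openConn a b) {d₀, d₁, d₂}
    have hLout : ((A.filter fun b => ω ∉ openConn a b) \ {d₀, d₁, d₂}).card ≤ (((A \ B).erase a) \ {d₀, d₁, d₂}).card :=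
      Finset.card_le_card (Finset.sdiff_subset_sdiff hsub le_rfl)
    have hin : 1 < ((A.filter fun b => ω ∉ openConn a b) ∩ {d₀, d₁, d₂}).card := by omega
    obtain ⟨u, hu, v, hv, huv⟩ := Finset.one_lt_card.1 hin
    have hu' := Finset.mem_inter.1 hu
    have hv' := Finset.mem_inter.1 hv
    have hul : ω ∉ openConn a u := (Finset.mem_filter.1 hu'.1).2
    have hvl : ω ∉ openConn a v := (Finset.mem_filter.1 hv'.1).2
    simp only [Finset.mem_insert, Finset.mem_singleton] at hu' hv'
    rcases hu'.2 with rfl | rfl | rfl <;> rcases hv'.2 with rfl | rfl | rfl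
    · exact absurd rfl huv
    · exact key 2 3 (by decide) (hx2 ▸ hul) (hx3 ▸ hvl)
    · exact key 2 4 (by decide) (hx2 ▸ hul) (hx4 ▸ hvl)
    · exact key 3 2 (by decide) (hx3 ▸ hul) (hx2 ▸ hvl)
    · exact absurd rfl huv
    · exact key 3 4 (by decide) (hx3 ▸ hul) (hx4 ▸ hvl)
    · exact key 4 2 (by decide) (hx4 ▸ hul) (hx2 ▸ hvl)
    · exact key 4 3 (by decide) (hx4 ▸ hul) (hx3 ▸ hvl)
    · exact absurd rfl huv
  · -- `a` cut from the block: `b` is lost, entered twice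
    exact key 0 1 (by decide) (hx0 ▸ hab) (hx1 ▸ hab)

/-- **(6P) ⇒ (LT³⁄₂) for one glued block carrying all but at most half-itself-plus-four-and-a-half of the relay points**, any observer,
every `0 < κ ≤ 2/3`: if `Consts.SixPointTwoLost` holds, `B ⊆ A` is almost surely glued to `t` and `2·|A ∖ B| ≤ |B| + 9`, then
`P(1 ≤ N < κ·EN) ≤ (3/2)·s`.  (`|A| ≤ 6` or `|A ∖ B| ≤ 3`: unconditional theorems; else footprint transfer at `k = |A| − ⌊|A|/3⌋`, block
points by `Consts.real_blockDeficit_block_le_of_four_free`, free points by `Consts.real_blockDeficit_free_le_of_sixPoint`.)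
[cite: KozmaNitzan2024, Conj. 1 (p. 3)] -/
theorem real_lowerTail_le_three_halves_of_glued_block_of_sixPoint (h6 : SixPointTwoLost) (n : ℕ)
    (w : Sym2 (Fin n) → unitInterval) (A : Finset (Fin n)) (o t : Fin n) (B : Finset (Fin n)) (hBA : B ⊆ A)
    (hglue : ∀ b ∈ B, (prodBernoulli w).real (openConn t b)ᶜ = 0) (hF : 2 * (A \ B).card ≤ B.card + 9)
    {κ s : ℝ} (hκ0 : 0 < κ) (hκ : κ ≤ 2 / 3) (hs : 0 ≤ s)
    (hrel : ∀ a ∈ A, ∀ a' ∈ A, (prodBernoulli w).real (openConn a a')ᶜ ≤ s) :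
    (prodBernoulli w).real {ω : BondConfig (Fin n) | 1 ≤ (A.filter fun a => ω ∈ openConn o a).card ∧
        ((A.filter fun a => ω ∈ openConn o a).card : ℝ) < κ * (∑ a ∈ A, (prodBernoulli w).real (openConn o a))} ≤
      3 / 2 * s := by
  by_cases hA6 : A.card ≤ 6
  · exact real_lowerTail_le_three_halves_of_card_le_six_any n w A o hA6 hκ0 hκ hs hrel
  by_cases hF3 : (A \ B).card ≤ 3
  · exact real_lowerTail_le_three_halves_of_glued_block_half n w A o t B hBA hglue (by omega) hκ0 hκ hs hrel
  set μ := prodBernoulli w with hμ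
  have hBF := Finset.card_sdiff_add_card_eq_card hBA
  set k : ℕ := A.card - A.card / 3 with hkdef
  have hk3 : A.card / 3 ≤ A.card := Nat.div_le_self _ _
  have hk : (A \ B).card + k ≤ A.card + 3 := by omega
  have hblk : ∀ a ∈ A, μ.real {ω : BondConfig (Fin n) | (A.filter fun b => ω ∈ openConn a b).card < k} ≤ 3 / 2 * s := by
    intro a ha
    by_cases haB : a ∈ B
    · obtain ⟨C, hC, hC4⟩ := Finset.exists_subset_card_eq (by omega : 4 ≤ (A \ B).card)
      exact real_blockDeficit_block_le_of_four_free n w A t B hBA hglue a haB C hC hC4 k hk hrel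
    · have haF : a ∈ A \ B := Finset.mem_sdiff.2 ⟨ha, haB⟩
      have h3 : 3 ≤ ((A \ B).erase a).card := by rw [Finset.card_erase_of_mem haF]; omega
      obtain ⟨D, hD, hD3⟩ := Finset.exists_subset_card_eq h3
      obtain ⟨d₀, d₁, d₂, h01, h02, h12, hDeq⟩ := Finset.card_eq_three.1 hD3
      have hd₀ : d₀ ∈ (A \ B).erase a := hD (by rw [hDeq]; simp)
      have hd₁ : d₁ ∈ (A \ B).erase a := hD (by rw [hDeq]; simp)
      have hd₂ : d₂ ∈ (A \ B).erase a := hD (by rw [hDeq]; simp)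
      have hBne : B.Nonempty := by rw [← Finset.card_pos]; omega
      obtain ⟨b, hb⟩ := hBne
      refine real_blockDeficit_free_le_of_sixPoint h6 n w A t B hBA hglue b hb a d₀ d₁ d₂ haF hd₀ hd₁ hd₂ h01 h02 h12 k ?_ hrel
      have hsub : ({d₀, d₁, d₂} : Finset (Fin n)) ⊆ (A \ B).erase a := by rw [← hDeq]; exact hD
      have hc3 : ({d₀, d₁, d₂} : Finset (Fin n)).card = 3 := Finset.card_eq_three.2 ⟨d₀, d₁, d₂, h01, h02, h12, rfl⟩
      have := Finset.card_sdiff_add_card_eq_card hsub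
      rw [hc3, Finset.card_erase_of_mem haF] at this
      omega
  have htr := lowerTail_le_blockDeficit n w A o k (3 / 2 * s) hblk
  have h32 : 3 / 2 * s * μ.real (⋃ a ∈ A, openConn o a) ≤ 3 / 2 * s := by
    have h0 : 0 ≤ 3 / 2 * s := by linarith
    have h1 : μ.real (⋃ a ∈ A, openConn o a) ≤ 1 := measureReal_le_one
    nlinarith [measureReal_nonneg (μ := μ) (s := ⋃ a ∈ A, openConn o a)]
  exact le_trans (measureReal_mono (lowerTail_subset_threshold n w A o hκ0 hκ)) (htr.trans h32)

end Consts

end Summit.CriticalPhenomena.PercolationContinuityZ3.Theorems
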